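import Summits.CriticalPhenomena.CardyFormulaZ2.Theorems.CardyMagicRigidityNestingRigidityUVCollarCrossers
import Summits.CriticalPhenomena.CardyFormulaZ2.Theorems.CardyMagicRigidityNestingRigidityUVCollarCount
import Summits.CriticalPhenomena.CardyFormulaZ2.Theorems.CardyMagicRigidityNestingRigidityUVExpMomentsAssembly
import Summits.CriticalPhenomena.CardyFormulaZ2.Theorems.CardyMagicRigidityNestingRigidityUVExpMomentsReduction
import HarnessLib

/-!
# Crux `NestingRigidity`, line `positive-cone-weight-doubling`: all-order exponential moments of the
# COLLAR-CROSSER STATISTIC `Σ_{u crosses a thin collar} min(1, diam(u)²/ρ'²)` at a general radius,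
# both lattices (helper K `uvCollar_expMoment_latticeEnsembles`)

Crux `Summit.CriticalPhenomena.CardyFormulaZ2.Theses.CardyMagicRigidity.NestingRigidity`
(stmt-CriticalPhenomena-4835), line `positive-cone-weight-doubling`, registered helper K
`uvCollar_expMoment_latticeEnsembles`.  Two of the three pieces of the collar statistic are sums,
over the loops crossing a thin collar `{ρ₁ ≤ |z| ≤ ρ₂}` (`ρ₂ − ρ₁ ≤ 2δ`), of a bite `≤ min(1, d²/ρ'²)`,
`d` the diameter of the loop (`TiltTransfer.discFrac_le_diam_sq_div`, `…ringFrac_le_diam_sq_div`):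
radius `r` and normalisation `ρ' = r` for the inner collar, radius `1` and `ρ' = 1` for the outer
one; the staircase of line `ring-cloud-tomography` has such collars at every ring radius.  This file
proves (registered anchor `expMoment_collarStat_le_latticeEnsembles`): for `E ∈ latticeEnsembles`
and every order `t > 0` there are `C` and `c > 0` with
`E_δ exp(t Σ_{u meets B̄(0,ρ₂), u ⊄ B(0,ρ₁)} min(1, diam(u)²/ρ'²)) ≤ C` whenever `c δ ≤ ρ'`,
`0 < ρ₁ ≤ ρ₂ ≤ ρ₁ + 2δ`, `ρ₂ ≤ 2ρ'` — ALL orders, uniformly in the radius.  Proof: scale by scale.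
* §1 (deterministic) with the dyadic scales `s_j = ρ'/2^j`, `j ≤ n`:
  `min(1, d²/ρ'²) ≤ Σ_{j ≤ n} (4/4^j)·[s_j ≤ d] + 1/4^n` (`UVCollar.min_one_sq_div_le_scaleSum`), so the
  statistic is `≤ Σ_j (4/4^j) N_j + #(all loops meeting B̄(0,ρ₂))/4^n`, `N_j` the number of crossers
  of diameter `≥ s_j`;
* §2 (probabilistic) choose the aspect ratio `K` with `e^{16t}(4/K)^α ≤ 1/2`
  (`TowerMomentUpper.exists_aspect`) and `2^n ≤ ρ'/(4Kc₀δ) < 2^{n+1}`: the crossers of diameter `≥ s_j`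
  pass through the collar (`UVCollar.exists_mem_range_norm_mem_Icc`) and leave every ball of radius
  `s_j/4`, so `E e^{λ N_j} ≤ exp(2(e^{2λ} − 1)(4/K)^α (16πKρ₂ 2^j/ρ' + 3))`
  (`expMoment_collarCount_le_latticeEnsembles`, cells of size `s_j/(4K) ≥ c₀δ`); with the weights
  `w_j = 2^{-j-1}` and `λ_j = 8t/2^j` the generalised Hölder assembly
  (`expMoment_scaleSum_le_latticeEnsembles`) gives `E e^{t Σ_j (4/4^j) N_j} ≤ exp(32 t e^{16t} (4/K)^α (32πK + 3))`,
  and the microscopic remainder is `≤ 32(ρ₂/δ + 5)²·(8Kc₀δ/ρ')² = O(1)` deterministically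
  (`ncard_loops_meeting_le_latticeEnsembles`).  No cited fact, no definition.
-/

noncomputable section

open MeasureTheory Set Filter Metric
open scoped Real Topology BigOperators ENNReal

namespace Summit.CriticalPhenomena.CardyFormulaZ2.Cruxes.NestingRigidity.PositiveConeWeightDoubling

open Literature.Probability.RandomPlanarGeometry Literature.Probability.Percolation
  Literature.Probability.LatticeModels
open Summit.CriticalPhenomena.CardyFormulaZ2.Cruxes.NestingRigidity.RingCloudTomography

namespace UVCollar

/-! ## §1 Deterministic: the bite of one loop, and of a finite family, scale by scale -/

/-- **One loop**: for `0 < ρ'`, `0 ≤ d` and `n : ℕ`,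
`min(1, d²/ρ'²) ≤ Σ_{j ≤ n} (4/(2^j)²)·[ρ'/2^j ≤ d] + 1/(2^n)²` (if `d ≥ ρ'/2^n` the first scale `k`
with `ρ'/2^k ≤ d` has `d < 2ρ'/2^k` or `k = 0`; otherwise the last term). -/
theorem min_one_sq_div_le_scaleSum {ρ' d : ℝ} (hρ' : 0 < ρ') (hd : 0 ≤ d) (n : ℕ) :
    min 1 (d ^ 2 / ρ' ^ 2) ≤
      ∑ j ∈ Finset.range (n + 1), 4 / (2 ^ j) ^ 2 * (if ρ' / 2 ^ j ≤ d then (1 : ℝ) else 0) +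
        1 / (2 ^ n) ^ 2 := by
  classical
  have hterm0 : ∀ j ∈ Finset.range (n + 1),
      (0 : ℝ) ≤ 4 / (2 ^ j) ^ 2 * (if ρ' / 2 ^ j ≤ d then (1 : ℝ) else 0) := fun j _ ↦ by
    split_ifs <;> positivity
  have hsum0 := Finset.sum_nonneg hterm0
  by_cases hmicro : d < ρ' / 2 ^ n
  · -- microscopic: `d²/ρ'² < 1/4^n`
    have h1 : d ^ 2 / ρ' ^ 2 ≤ 1 / (2 ^ n) ^ 2 := by
      rw [div_le_div_iff₀ (by positivity) (by positivity), one_mul]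
      have h2 : d * 2 ^ n < ρ' := by rwa [lt_div_iff₀ (by positivity)] at hmicro
      have h3 : 0 ≤ d * 2 ^ n := by positivity
      nlinarith
    linarith [min_le_right (1 : ℝ) (d ^ 2 / ρ' ^ 2)]
  · push Not at hmicro
    have hex : ∃ j, ρ' / 2 ^ j ≤ d := ⟨n, hmicro⟩
    set k := Nat.find hex with hk
    have hkd : ρ' / 2 ^ k ≤ d := Nat.find_spec hex
    have hkn : k ≤ n := Nat.find_min' hex hmicro
    have hkmem : k ∈ Finset.range (n + 1) := Finset.mem_range.2 (Nat.lt_succ_of_le hkn)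
    have hsingle : 4 / (2 ^ k) ^ 2 * (if ρ' / 2 ^ k ≤ d then (1 : ℝ) else 0) ≤
        ∑ j ∈ Finset.range (n + 1), 4 / (2 ^ j) ^ 2 * (if ρ' / 2 ^ j ≤ d then (1 : ℝ) else 0) :=
      Finset.single_le_sum hterm0 hkmem
    rw [if_pos hkd, mul_one] at hsingle
    have hmin : min 1 (d ^ 2 / ρ' ^ 2) ≤ 4 / (2 ^ k) ^ 2 := by
      rcases Nat.eq_zero_or_pos k with hk0 | hkpos
      · rw [hk0, pow_zero, one_pow, div_one]
        linarith [min_le_left (1 : ℝ) (d ^ 2 / ρ' ^ 2)]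
      · obtain ⟨k', hk'⟩ := Nat.exists_eq_succ_of_ne_zero hkpos.ne'
        have hlt : ¬ ρ' / 2 ^ k' ≤ d := Nat.find_min hex (by rw [← hk, hk']; exact Nat.lt_succ_self k')
        push Not at hlt
        refine (min_le_right _ _).trans ?_
        rw [div_le_div_iff₀ (by positivity) (by positivity)]
        rw [lt_div_iff₀ (by positivity)] at hlt
        have e : (2 : ℝ) ^ k = 2 * 2 ^ k' := by rw [hk', pow_succ]; ring
        rw [e]
        have h3 : 0 ≤ d * 2 ^ k' := by positivity
        nlinarith
    have : (0 : ℝ) ≤ 1 / (2 ^ n) ^ 2 := by positivity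
    linarith

/-- **A finite family**: `Σ_{u ∈ 𝒞} min(1, diam(u)²/ρ'²) ≤ Σ_{j ≤ n} (4/(2^j)²) #{u ∈ 𝒞 : ρ'/2^j ≤ diam u} + #𝒞/(2^n)²`. -/
theorem sum_min_le_scaleSum {ρ' : ℝ} (hρ' : 0 < ρ') (n : ℕ) (𝒞 : Finset (UnbasedLoop ℂ)) :
    ∑ u ∈ 𝒞, min 1 (diam u.range ^ 2 / ρ' ^ 2) ≤
      ∑ j ∈ Finset.range (n + 1), 4 / (2 ^ j) ^ 2 *
        ((𝒞.filter fun u ↦ ρ' / 2 ^ j ≤ diam u.range).card : ℝ) + 𝒞.card / (2 ^ n) ^ 2 := by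
  classical
  calc ∑ u ∈ 𝒞, min 1 (diam u.range ^ 2 / ρ' ^ 2)
      ≤ ∑ u ∈ 𝒞, (∑ j ∈ Finset.range (n + 1), 4 / (2 ^ j) ^ 2 *
          (if ρ' / 2 ^ j ≤ diam u.range then (1 : ℝ) else 0) + 1 / (2 ^ n) ^ 2) :=
        Finset.sum_le_sum fun u _ ↦ min_one_sq_div_le_scaleSum hρ' diam_nonneg n
    _ = ∑ j ∈ Finset.range (n + 1), 4 / (2 ^ j) ^ 2 *
          ((𝒞.filter fun u ↦ ρ' / 2 ^ j ≤ diam u.range).card : ℝ) + 𝒞.card / (2 ^ n) ^ 2 := by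
        rw [Finset.sum_add_distrib, Finset.sum_comm, Finset.sum_const, nsmul_eq_mul]
        congr 1
        · refine Finset.sum_congr rfl fun j _ ↦ ?_
          rw [← Finset.mul_sum, Finset.sum_boole]
        · ring

/-- **Leaving small balls**: a loop of diameter `≥ s > 0` is not drawn inside any ball of radius
`s/4`. -/
theorem range_inter_compl_ball_nonempty_of_diam (u : UnbasedLoop ℂ) {s : ℝ} (hs : 0 < s)
    (hd : s ≤ diam u.range) (x : ℂ) : (u.range ∩ (ball x (s / 4))ᶜ).Nonempty := by
  by_contra h
  have hsub : u.range ⊆ ball x (s / 4) := fun z hz ↦ by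
    by_contra hz'
    exact h ⟨z, hz, hz'⟩
  have := (diam_mono hsub isBounded_ball).trans (diam_ball (by positivity : (0 : ℝ) ≤ s / 4))
  linarith

/-- **The scale-`j` rate, summed form**: with `λ_j = 8t/2^j`, cells of size `ρ'/(4K 2^j)` at radius
`ρ₂ ≤ 2ρ'` and weight `w_j = 1/(2·2^j)`,
`w_j · 2(e^{2λ_j} − 1) p (4πρ₂/(ρ'/(4K2^j)) + 3) ≤ 32 t e^{16t} p (32πK + 3) · (1/2)(1/2)^j`. -/
theorem scaleRate_le {t p K ρ₂ ρ' : ℝ} (ht : 0 ≤ t) (hp : 0 ≤ p) (hK : 0 ≤ K) (hρ' : 0 < ρ')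
    (hρ₂ : 0 ≤ ρ₂) (h2 : ρ₂ ≤ 2 * ρ') (j : ℕ) :
    1 / (2 * 2 ^ j) * (2 * (Real.exp (2 * (8 * t / 2 ^ j)) - 1) * p *
      (4 * π * ρ₂ / (ρ' / (4 * K * 2 ^ j)) + 3)) ≤
      32 * t * Real.exp (16 * t) * p * (32 * π * K + 3) * (1 / 2 * (1 / 2) ^ j) := by
  have h2j1 : (1 : ℝ) ≤ 2 ^ j := one_le_pow₀ one_le_two
  have h2j0 : (0 : ℝ) < 2 ^ j := by positivity
  have hl : 0 ≤ 2 * (8 * t / 2 ^ j) := by positivity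
  -- the two factors
  have hA0 : 0 ≤ Real.exp (2 * (8 * t / 2 ^ j)) - 1 := by linarith [Real.one_le_exp hl]
  have hA : Real.exp (2 * (8 * t / 2 ^ j)) - 1 ≤ 16 * t / 2 ^ j * Real.exp (16 * t) := by
    -- `e^x − 1 ≤ x e^x` (`1 − x ≤ e^{−x}`), as in `AreaLaw.exp_sub_one_le_mul_exp`
    have hxe : ∀ x : ℝ, Real.exp x - 1 ≤ x * Real.exp x := fun x ↦ by
      have h := Real.add_one_le_exp (-x)
      rw [Real.exp_neg] at h
      have hpos := Real.exp_pos x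
      have : (-x + 1) * Real.exp x ≤ 1 := by
        calc (-x + 1) * Real.exp x ≤ (Real.exp x)⁻¹ * Real.exp x :=
              mul_le_mul_of_nonneg_right h hpos.le
          _ = 1 := inv_mul_cancel₀ hpos.ne'
      nlinarith
    refine (hxe _).trans ?_
    have e : 2 * (8 * t / 2 ^ j) = 16 * t / 2 ^ j := by ring
    rw [e]
    refine mul_le_mul_of_nonneg_left (Real.exp_le_exp.2 ?_) (by positivity)
    rw [div_le_iff₀ h2j0]; nlinarith
  have hB0 : 0 ≤ 4 * π * ρ₂ / (ρ' / (4 * K * 2 ^ j)) + 3 := by positivity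
  have hB : 4 * π * ρ₂ / (ρ' / (4 * K * 2 ^ j)) + 3 ≤ (32 * π * K + 3) * 2 ^ j := by
    have e : 4 * π * ρ₂ / (ρ' / (4 * K * 2 ^ j)) = 16 * π * K * 2 ^ j * (ρ₂ / ρ') := by
      field_simp; ring
    rw [e]
    have hr : ρ₂ / ρ' ≤ 2 := by rw [div_le_iff₀ hρ']; linarith
    nlinarith [Real.pi_pos, mul_le_mul_of_nonneg_left hr (by positivity : 0 ≤ 16 * π * K * 2 ^ j)]
  have hprod : (Real.exp (2 * (8 * t / 2 ^ j)) - 1) * (4 * π * ρ₂ / (ρ' / (4 * K * 2 ^ j)) + 3) ≤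
      (16 * t / 2 ^ j * Real.exp (16 * t)) * ((32 * π * K + 3) * 2 ^ j) :=
    mul_le_mul hA hB hB0 (by positivity)
  have e2 : 32 * t * Real.exp (16 * t) * p * (32 * π * K + 3) * (1 / 2 * (1 / 2) ^ j) =
      1 / (2 * 2 ^ j) * (2 * p * ((16 * t / 2 ^ j * Real.exp (16 * t)) * ((32 * π * K + 3) * 2 ^ j))) := by
    rw [one_div_pow]; field_simp; ring
  rw [e2]
  refine mul_le_mul_of_nonneg_left ?_ (by positivity)
  nlinarith [mul_le_mul_of_nonneg_left hprod (by positivity : 0 ≤ 2 * p)]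

/-- **The microscopic remainder is `O(1)`**: `#𝒞/(2^n)² ≤ 32·9·(8Kc₀)²` when
`#𝒞 ≤ 32(ρ₂/δ + 5)²`, `1/2^n ≤ 8Kc₀δ/ρ'`, `ρ₂ ≤ 2ρ'` and `5δ ≤ ρ'`. -/
theorem microRemainder_le {K c₀ δ ρ' ρ₂ m : ℝ} (hK : 0 ≤ K) (hc₀ : 0 ≤ c₀) (hδ : 0 < δ) (hρ' : 0 < ρ')
    (h5 : 5 * δ ≤ ρ') (hρ₂ : 0 ≤ ρ₂) (h2 : ρ₂ ≤ 2 * ρ') (hm : m ≤ 32 * (ρ₂ / δ + 5) ^ 2) {n : ℕ}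
    (hn : 1 / (2 : ℝ) ^ n ≤ 8 * K * c₀ * δ / ρ') : m / (2 ^ n) ^ 2 ≤ 32 * 9 * (8 * K * c₀) ^ 2 := by
  have e : m / (2 ^ n) ^ 2 = m * (1 / 2 ^ n) ^ 2 := by field_simp
  rw [e]
  have h1 : (1 / (2 : ℝ) ^ n) ^ 2 ≤ (8 * K * c₀ * δ / ρ') ^ 2 := pow_le_pow_left₀ (by positivity) hn 2
  have hy : (ρ₂ / δ + 5) * (8 * K * c₀ * δ / ρ') ≤ 3 * (8 * K * c₀) := by
    have e2 : (ρ₂ / δ + 5) * (8 * K * c₀ * δ / ρ') = 8 * K * c₀ * ((ρ₂ + 5 * δ) / ρ') := by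
      field_simp
    rw [e2]
    have hr : (ρ₂ + 5 * δ) / ρ' ≤ 3 := by rw [div_le_iff₀ hρ']; linarith
    nlinarith [mul_le_mul_of_nonneg_left hr (by positivity : 0 ≤ 8 * K * c₀)]
  have hy0 : 0 ≤ (ρ₂ / δ + 5) * (8 * K * c₀ * δ / ρ') := by positivity
  calc m * (1 / 2 ^ n) ^ 2 ≤ 32 * (ρ₂ / δ + 5) ^ 2 * (8 * K * c₀ * δ / ρ') ^ 2 :=
        mul_le_mul hm h1 (by positivity) (by positivity)
    _ = 32 * ((ρ₂ / δ + 5) * (8 * K * c₀ * δ / ρ')) ^ 2 := by ring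
    _ ≤ 32 * (3 * (8 * K * c₀)) ^ 2 := by
        gcongr
    _ = 32 * 9 * (8 * K * c₀) ^ 2 := by ring

/-! ## §2 The exponential moments of the collar-crosser statistic -/

/-- **All-order exponential moments of the collar-crosser statistic, both lattices** (the
quantitative form behind the registered anchor: explicit `C`, `c` in terms of the lattice constants
`α, c₀` of `expMoment_collarCount_le_latticeEnsembles` and the aspect ratio `K`). -/
theorem expMoment_collarStat_le : ∀ E ∈ latticeEnsembles, ∀ {t : ℝ}, 0 < t →
    ∃ C c : ℝ, 0 < c ∧ ∀ (δ ρ₁ ρ₂ ρ' : ℝ), 0 < δ → c * δ ≤ ρ' → 0 < ρ₁ → ρ₁ ≤ ρ₂ →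
      ρ₂ ≤ ρ₁ + 2 * δ → ρ₂ ≤ 2 * ρ' →
      Integrable (fun ω ↦ Real.exp (t * ∑ᶠ u ∈ {u ∈ (E.X δ ω).loops |
        (u.range ∩ closedBall (0 : ℂ) ρ₂).Nonempty ∧ ¬ u.range ⊆ ball (0 : ℂ) ρ₁},
          min 1 (diam u.range ^ 2 / ρ' ^ 2))) E.P ∧
      ∫ ω, Real.exp (t * ∑ᶠ u ∈ {u ∈ (E.X δ ω).loops |
        (u.range ∩ closedBall (0 : ℂ) ρ₂).Nonempty ∧ ¬ u.range ⊆ ball (0 : ℂ) ρ₁},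
          min 1 (diam u.range ^ 2 / ρ' ^ 2)) ∂E.P ≤ C := by
  intro E hE t ht
  haveI := isProbabilityMeasure_of_mem hE
  obtain ⟨α, c₀, hα, hc₀4, hCT⟩ := expMoment_collarCount_le_latticeEnsembles E hE
  have hc₀ : 0 < c₀ := by linarith
  obtain ⟨K, hK8, hKw⟩ := TowerMomentUpper.exists_aspect (w := Real.exp (8 * t)) (Real.one_le_exp (by positivity)) hα
  have hK8' : (8 : ℝ) ≤ K := by exact_mod_cast hK8
  have hK0 : (0 : ℝ) < K := by linarith
  set p : ℝ := (4 / (K : ℝ)) ^ α with hp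
  have hp0 : 0 ≤ p := by positivity
  have hq16 : Real.exp (16 * t) * p ≤ 1 / 2 := by
    have e : Real.exp (8 * t) ^ 2 = Real.exp (16 * t) := by rw [← Real.exp_nat_mul]; ring_nf
    rw [← e]; exact hKw
  -- the constants
  set D : ℝ := 32 * 9 * (8 * K * c₀) ^ 2 with hD
  set β : ℝ := 32 * t * Real.exp (16 * t) * p * (32 * π * K + 3) with hβ
  refine ⟨Real.exp (t * D) * Real.exp β, 4 * K * c₀, by positivity,
    fun δ ρ₁ ρ₂ ρ' hδ hcδ hρ₁ h12 h21 h2' ↦ ?_⟩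
  have hρ' : 0 < ρ' := lt_of_lt_of_le (by positivity) hcδ
  have hρ₂ : 0 < ρ₂ := lt_of_lt_of_le hρ₁ h12
  have h5δ : 5 * δ ≤ ρ' := by
    have h5 : (5 : ℝ) ≤ 4 * K * c₀ := by nlinarith
    exact le_trans (mul_le_mul_of_nonneg_right h5 hδ.le) hcδ
  -- the number of scales
  set x : ℝ := ρ' / (4 * K * c₀ * δ) with hx
  have hx1 : 1 ≤ x := by rw [hx, le_div_iff₀ (by positivity)]; linarith
  obtain ⟨n, hn1, hn2⟩ := exists_nat_pow_near hx1 one_lt_two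
  -- cell sizes `a_j = ρ'/(4K 2^j) ≥ c₀ δ` for `j ≤ n`, and the microscopic threshold
  have haj : ∀ j ∈ Finset.range (n + 1), c₀ * δ ≤ ρ' / (4 * K * 2 ^ j) := by
    intro j hj
    have hjn : j ≤ n := Nat.lt_succ_iff.1 (Finset.mem_range.1 hj)
    have h2j : (2 : ℝ) ^ j ≤ 2 ^ n := pow_le_pow_right₀ one_le_two hjn
    rw [le_div_iff₀ (by positivity)]
    rw [hx, le_div_iff₀ (by positivity)] at hn1
    nlinarith [mul_le_mul_of_nonneg_left h2j (by positivity : 0 ≤ c₀ * δ * (4 * K))]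
  have hmicro : 1 / (2 : ℝ) ^ n ≤ 8 * K * c₀ * δ / ρ' := by
    rw [hx, div_lt_iff₀ (by positivity), pow_succ] at hn2
    rw [div_le_div_iff₀ (by positivity) hρ', one_mul]
    nlinarith
  -- the crossers, the scale counts and their exponential moments
  set cross : UnbasedLoop ℂ → Prop := fun u ↦
    (u.range ∩ closedBall (0 : ℂ) ρ₂).Nonempty ∧ ¬ u.range ⊆ ball (0 : ℂ) ρ₁ with hcross
  set N : ℕ → E.Ω → ℕ := fun j ω ↦ {u ∈ (E.X δ ω).loops | cross u ∧ ρ' / 2 ^ j ≤ diam u.range}.ncard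
    with hN
  have hNm : ∀ j, Measurable (N j) := fun j ↦ BigLoops.measurable_ncard_loops_sep E hE δ _
  have hscale : ∀ j ∈ Finset.range (n + 1),
      Integrable (fun ω ↦ Real.exp (8 * t / 2 ^ j * (N j ω : ℝ))) E.P ∧
      ∫ ω, Real.exp (8 * t / 2 ^ j * (N j ω : ℝ)) ∂E.P ≤
        Real.exp (2 * (Real.exp (2 * (8 * t / 2 ^ j)) - 1) * p * (4 * π * ρ₂ / (ρ' / (4 * K * 2 ^ j)) + 3)) := by
    intro j hj
    have h2j1 : (1 : ℝ) ≤ 2 ^ j := one_le_pow₀ one_le_two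
    have hl : 0 ≤ 8 * t / 2 ^ j := by positivity
    have hq : Real.exp (2 * (8 * t / 2 ^ j)) * p ≤ 1 / 2 := by
      refine le_trans (mul_le_mul_of_nonneg_right (Real.exp_le_exp.2 ?_) hp0) hq16
      rw [← mul_div_assoc, div_le_iff₀ (by positivity)]
      nlinarith
    have ha := haj j hj
    have ha4 : 4 * δ ≤ ρ' / (4 * K * 2 ^ j) := le_trans (by nlinarith) ha
    refine hCT K δ ρ₂ (ρ' / (4 * K * 2 ^ j)) (8 * t / 2 ^ j) _ hK8' hδ ha hρ₂ hl hq fun u hu ↦ ⟨?_, ?_⟩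
    · obtain ⟨z, hz, hz1, hz2⟩ := exists_mem_range_norm_mem_Icc u h12 hu.1.1 hu.1.2
      exact ⟨z, hz, by linarith, hz2⟩
    · intro y _
      have e : (K : ℝ) * (ρ' / (4 * K * 2 ^ j)) = (ρ' / 2 ^ j) / 4 := by field_simp
      rw [e]
      exact range_inter_compl_ball_nonempty_of_diam u (by positivity) hu.2 y
  -- the Hölder assembly across scales
  set Z : ℕ → E.Ω → ℝ := fun j ω ↦ 4 * t / (2 ^ j) ^ 2 * (N j ω : ℝ) with hZ
  set w : ℕ → ℝ := fun j ↦ 1 / (2 * 2 ^ j) with hw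
  set B : ℕ → ℝ := fun j ↦ w j * (2 * (Real.exp (2 * (8 * t / 2 ^ j)) - 1) * p *
    (4 * π * ρ₂ / (ρ' / (4 * K * 2 ^ j)) + 3)) with hB
  have hw0 : ∀ j ∈ Finset.range (n + 1), 0 < w j := fun j _ ↦ by positivity
  have hw1 : ∑ j ∈ Finset.range (n + 1), w j ≤ 1 := by
    have hgeom := BigLoopsExp.geom_sum_range_le_two (x := 1 / 2) (by norm_num) (by norm_num) (n + 1)
    have e : ∀ j ∈ Finset.range (n + 1), w j = 1 / 2 * (1 / 2) ^ j := fun j _ ↦ by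
      rw [hw]; dsimp only; rw [one_div_pow]; field_simp
    rw [Finset.sum_congr rfl e, ← Finset.mul_sum]
    linarith
  have hZw : ∀ j ω, Z j ω / w j = 8 * t / 2 ^ j * (N j ω : ℝ) := fun j ω ↦ by
    rw [hZ, hw]; dsimp only; field_simp; ring
  have hBw : ∀ j, B j / w j = 2 * (Real.exp (2 * (8 * t / 2 ^ j)) - 1) * p *
      (4 * π * ρ₂ / (ρ' / (4 * K * 2 ^ j)) + 3) := fun j ↦ by
    have : w j ≠ 0 := by positivity
    rw [hB]; dsimp only; field_simp
  obtain ⟨hIsum, hsum⟩ := expMoment_scaleSum_le_latticeEnsembles E hE (n + 1) Z w B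
    (fun j _ ↦ (measurable_from_nat.comp (hNm j)).const_mul _) hw0 hw1 fun j hj ↦ by
      simp_rw [hZw j, hBw j]; exact hscale j hj
  -- the sum of the scale bounds
  have hBle : ∀ j ∈ Finset.range (n + 1), B j ≤ β * (1 / 2 * (1 / 2) ^ j) := fun j _ ↦
    scaleRate_le ht.le hp0 hK0.le hρ' hρ₂.le h2' j
  have hBsum : ∑ j ∈ Finset.range (n + 1), B j ≤ β := by
    have hgeom := BigLoopsExp.geom_sum_range_le_two (x := 1 / 2) (by norm_num) (by norm_num) (n + 1)
    calc ∑ j ∈ Finset.range (n + 1), B j ≤ ∑ j ∈ Finset.range (n + 1), β * (1 / 2 * (1 / 2) ^ j) :=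
          Finset.sum_le_sum hBle
      _ = β * (1 / 2) * ∑ j ∈ Finset.range (n + 1), (1 / 2 : ℝ) ^ j := by
          rw [Finset.mul_sum]; exact Finset.sum_congr rfl fun j _ ↦ by ring
      _ ≤ β * (1 / 2) * 2 := mul_le_mul_of_nonneg_left hgeom (by positivity)
      _ = β := by ring
  -- the statistic: measurability, boundedness, the pathwise domination
  set S : E.Ω → ℝ := fun ω ↦ ∑ᶠ u ∈ {u ∈ (E.X δ ω).loops | cross u},
    min 1 (diam u.range ^ 2 / ρ' ^ 2) with hS
  have hSm : Measurable S := FirstMoment.measurable_finsum_loops_sep E hE δ cross _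
  have hg1 : ∀ u : UnbasedLoop ℂ, |min 1 (diam u.range ^ 2 / ρ' ^ 2)| ≤ 1 := fun u ↦ by
    rw [abs_of_nonneg (le_min zero_le_one (by positivity))]; exact min_le_left _ _
  obtain ⟨Nδ, hNδ⟩ := FirstMoment.exists_ncard_loops_meeting_le E hE hδ ρ₂
  have hSb : ∀ ω, |S ω| ≤ Nδ := fun ω ↦ by
    have hsupp : {u ∈ (E.X δ ω).loops | cross u} ∩
        Function.support (fun u : UnbasedLoop ℂ ↦ min 1 (diam u.range ^ 2 / ρ' ^ 2)) ⊆
        {u ∈ (E.X δ ω).loops | (u.range ∩ closedBall (0 : ℂ) ρ₂).Nonempty} :=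
      fun u hu ↦ ⟨hu.1.1, hu.1.2.1⟩
    have h := FirstMoment.abs_finsum_mem_le (hNδ ω).1 hsupp zero_le_one hg1
    rw [one_mul] at h
    exact h.trans (by exact_mod_cast (hNδ ω).2)
  have hSint : Integrable (fun ω ↦ Real.exp (t * S ω)) E.P :=
    UVExpMoments.integrable_exp_of_abs_le E hE S t Nδ hSm hSb
  have hdom : ∀ ω, t * S ω ≤ ∑ j ∈ Finset.range (n + 1), Z j ω + t * D := by
    intro ω
    have hfinall := (ncard_loops_meeting_le_latticeEnsembles E hE δ ρ₂ ω hδ hρ₂.le)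
    have hCfin : {u ∈ (E.X δ ω).loops | cross u}.Finite :=
      hfinall.1.subset fun u hu ↦ ⟨hu.1, hu.2.1⟩
    have hSeq : S ω = ∑ u ∈ hCfin.toFinset, min 1 (diam u.range ^ 2 / ρ' ^ 2) :=
      finsum_mem_eq_finite_toFinset_sum _ hCfin
    have hsub : {u ∈ (E.X δ ω).loops | cross u} ⊆
        {u ∈ (E.X δ ω).loops | (u.range ∩ closedBall (0 : ℂ) ρ₂).Nonempty} :=
      fun u hu ↦ ⟨hu.1, hu.2.1⟩
    have hcard : (hCfin.toFinset.card : ℝ) ≤ 32 * (ρ₂ / δ + 5) ^ 2 := by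
      rw [← Set.ncard_eq_toFinset_card _ hCfin]
      exact le_trans (by exact_mod_cast Set.ncard_le_ncard hsub hfinall.1) hfinall.2
    have hfilt : ∀ j, ((hCfin.toFinset.filter fun u ↦ ρ' / 2 ^ j ≤ diam u.range).card : ℝ) = N j ω := by
      intro j
      have hset : (↑(hCfin.toFinset.filter fun u ↦ ρ' / 2 ^ j ≤ diam u.range) : Set (UnbasedLoop ℂ)) =
          {u ∈ (E.X δ ω).loops | cross u ∧ ρ' / 2 ^ j ≤ diam u.range} := by
        ext u
        simp only [Finset.coe_filter, Set.Finite.mem_toFinset, Set.mem_setOf_eq, and_assoc]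
      rw [hN]; dsimp only
      rw [← hset, Set.ncard_coe_finset]
    have hstep := sum_min_le_scaleSum hρ' n hCfin.toFinset
    simp_rw [hfilt] at hstep
    have hmic : (hCfin.toFinset.card : ℝ) / (2 ^ n) ^ 2 ≤ D :=
      microRemainder_le hK0.le hc₀.le hδ hρ' h5δ hρ₂.le h2' hcard hmicro
    have hZsum : t * ∑ j ∈ Finset.range (n + 1), 4 / (2 ^ j) ^ 2 * (N j ω : ℝ) =
        ∑ j ∈ Finset.range (n + 1), Z j ω := by
      rw [Finset.mul_sum]; exact Finset.sum_congr rfl fun j _ ↦ by rw [hZ]; ring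
    rw [hSeq, ← hZsum]
    nlinarith [hstep, hmic, ht]
  -- integrate
  refine ⟨hSint, ?_⟩
  have hmaj : Integrable (fun ω ↦ Real.exp (t * D) * Real.exp (∑ j ∈ Finset.range (n + 1), Z j ω)) E.P :=
    hIsum.const_mul _
  calc ∫ ω, Real.exp (t * S ω) ∂E.P
      ≤ ∫ ω, Real.exp (t * D) * Real.exp (∑ j ∈ Finset.range (n + 1), Z j ω) ∂E.P := by
        refine integral_mono hSint hmaj fun ω ↦ ?_
        rw [← Real.exp_add]
        exact Real.exp_le_exp.2 (by linarith [hdom ω])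
    _ = Real.exp (t * D) * ∫ ω, Real.exp (∑ j ∈ Finset.range (n + 1), Z j ω) ∂E.P := integral_const_mul _ _
    _ ≤ Real.exp (t * D) * Real.exp β :=
        mul_le_mul_of_nonneg_left (hsum.trans (Real.exp_le_exp.2 hBsum)) (Real.exp_pos _).le

end UVCollar

/-! ## §3 Registered anchor -/

/-- **Anchor (helper toward K `uvCollar_expMoment_latticeEnsembles`): all-order exponential moments
of the COLLAR-CROSSER STATISTIC at a general radius, both lattices.**  For `E ∈ latticeEnsembles`
and every order `t > 0` there are `C` and `c > 0` such that for every mesh `δ > 0`, normalising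
radius `ρ' ≥ c δ` and thin collar `0 < ρ₁ ≤ ρ₂ ≤ ρ₁ + 2δ` with `ρ₂ ≤ 2ρ'`:
`E_δ exp(t · Σ_{u ∈ X_δ, trace u ∩ B̄(0,ρ₂) ≠ ∅, trace u ⊄ B(0,ρ₁)} min(1, diam(trace u)²/ρ'²)) ≤ C`
(integrability included) — uniformly in the radius; the inner collar of the cone cloud is
`(ρ₁, ρ₂, ρ') = (r − 2δ, r, r)` (`φ_u ≤ min(1, diam²/r²)`), the outer one `(1, 1 + 2δ, 1)`
(`ψ_u ≤ min(1, diam²/3)`), and the staircase collars of line `ring-cloud-tomography` are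
`(M_k − 2δ, M_k, M_k)`, … (`UVCollar.expMoment_collarStat_le`). -/
theorem expMoment_collarStat_le_latticeEnsembles : ∀ E ∈ latticeEnsembles, ∀ t : ℝ, 0 < t → ∃ C c : ℝ, 0 < c ∧ ∀ (δ ρ₁ ρ₂ ρ' : ℝ), 0 < δ → c * δ ≤ ρ' → 0 < ρ₁ → ρ₁ ≤ ρ₂ → ρ₂ ≤ ρ₁ + 2 * δ → ρ₂ ≤ 2 * ρ' → Integrable (fun ω ↦ Real.exp (t * ∑ᶠ u ∈ {u ∈ (E.X δ ω).loops | (u.range ∩ Metric.closedBall (0 : ℂ) ρ₂).Nonempty ∧ ¬ u.range ⊆ Metric.ball (0 : ℂ) ρ₁}, min 1 (Metric.diam u.range ^ 2 / ρ' ^ 2))) E.P ∧ ∫ ω, Real.exp (t * ∑ᶠ u ∈ {u ∈ (E.X δ ω).loops | (u.range ∩ Metric.closedBall (0 : ℂ) ρ₂).Nonempty ∧ ¬ u.range ⊆ Metric.ball (0 : ℂ) ρ₁}, min 1 (Metric.diam u.range ^ 2 / ρ' ^ 2)) ∂E.P ≤ C := by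
  intro E hE t ht
  exact UVCollar.expMoment_collarStat_le E hE ht

end Summit.CriticalPhenomena.CardyFormulaZ2.Cruxes.NestingRigidity.PositiveConeWeightDoubling

end
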